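import Summits.Ventures.LatticeQCDFlow.Exactness.IMHCommonRandomNumbersMeetingTimeLaw
import Summits.Ventures.LatticeQCDFlow.Exactness.IMHCommonRandomNumbersSharp
import HarnessLib

/-!
# The moments of the meeting time are attained: from (cold, off-mode) the disagreement time of two coupled flow-MCMC runs has
# `E[T_M] = Σ_{n<M} rⁿ → W` and `E[T_M²] = Σ_{k<M}(2k + 1)r^k → W(2W − 1)` EXACTLY — the constants of the expectation and
# second-moment certificates are sharp

HONEST FRAMING: exact (Metropolis-corrected) sampling algorithms for lattice gauge theory;
figures of merit are autocorrelation/cost numbers at stated couplings and volumes; no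
continuum-physics claim.

Venture `LatticeQCDFlow` (cell pub-lqcd), topic `Exactness`; FANOUT row 30 (lean-1, GEN-38).  NEW WORK of the cell,
general state space with measurable points and a measurable diagonal; sequel to this generation's
`Exactness/IMHCommonRandomNumbersMeetingTimeLaw` (`E[T_M²] ≤ P(X_0 ≠ X′_0)·W(2W − 1)` for the disagreement time
`T_M = #{n < M : X_n ≠ X′_n}` of the CRN pair chain of `K = indepMH q w`, `W = w(x₀)`, `r = 1 − 1/W`; «NOT CLAIMED: optimality of
`W(2W − 1)`»), to GEN-37's `Exactness/IMHCommonRandomNumbersMeetingTime` (`E[T_M] ≤ P(X_0 ≠ X′_0)·W`) and to GEN-36's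
`Exactness/IMHCommonRandomNumbersSharp` (from the coupling (cold = at the mode `x₀`, any run never at the mode) with an atom-free
proposal, `P(X_n ≠ X′_n) = rⁿ` EXACTLY).  Here both moment bounds are shown to be ATTAINED by that coupling:

* §1 **`disagreementCount_sq_eq`** — pathwise, when merged runs stay merged along `z` (almost sure, `…MergedForever`), the
  disagreement set is an initial segment and `T_M² = Σ_{k<M}(2k + 1)·1{z_k ∉ Δ}` EXACTLY [bookkeeping];
  **`crn_chain_integral_disagreementCount_sq_eq`** — hence on the pair path law from EVERY initial coupling
  `E[T_M²] = Σ_{k<M}(2k + 1)·P(X_k ≠ X′_k)` and (**`crn_chain_integral_disagreementCount_eq`**) `E[T_M] = Σ_{k<M} P(X_k ≠ X′_k)`.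
* §2 (cold, off-mode; `q{x₀} = 0`) **`crn_chain_integral_disagreementCount_eq_cold`** — `E[T_M] = Σ_{n<M} rⁿ = W(1 − r^M)`;
  **`crn_chain_integral_disagreementCount_sq_eq_cold`** — `E[T_M²] = Σ_{k<M}(2k + 1)r^k`;
  **`crn_chain_disagreementCount_tail_eq_cold`** — `P(T_M ≥ t) = r^{t−1}` for `1 ≤ t ≤ M`: the geometric law exactly.
* §3 **`tendsto_integral_disagreementCount_cold`** — `E[T_M] → W` and **`tendsto_integral_disagreementCount_sq_cold`** —
  `E[T_M²] → W(2W − 1)` as `M → ∞`: THE CONSTANTS `W` AND `W(2W − 1)` OF THE TWO CERTIFICATES ARE SHARP.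
Reading (gauge files): a cold-started and a hot-started exact gauge sampler on one stream of random numbers disagree during a
number of updates whose mean tends to exactly `1/A` and whose second moment tends to exactly `(1/A)(2/A − 1)`.
NOT CLAIMED: the moments for two non-modal starts (upper bounds only, `…MeetingTimeLaw`); proposals with an atom at the mode;
any value of `A`.  No `sorry`, no new definitions, nothing cited as a fact.
-/

noncomputable section

namespace Summit.Ventures.LatticeQCDFlow.Exactness

open MeasureTheory ProbabilityTheory Function Finset Filter
open scoped ENNReal unitInterval Topology
open Summit.Ventures.LatticeQCDFlow.Scoring

variable {Ω : Type*} [MeasurableSpace Ω] {q : Measure Ω} [IsProbabilityMeasure q] {w : Ω → ℝ}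

/-! ## §1 Along a path where merged runs stay merged, `T_M² = Σ_{k<M}(2k + 1)·1{z_k ∉ Δ}` -/

omit [MeasurableSpace Ω] in
/-- Pathwise: if merged runs stay merged along `z`, then `(Σ_{n<M} 1{z_n ∉ Δ})² = Σ_{k<M}(2k + 1)·1{z_k ∉ Δ}`. [ours, bookkeeping] -/
theorem disagreementCount_sq_eq {z : ℕ → Ω × Ω}
    (hz : ∀ n m, n ≤ m → z n ∈ Set.diagonal Ω → z m ∈ Set.diagonal Ω) :
    ∀ M : ℕ, (∑ n ∈ Finset.range M, ((Set.diagonal Ω)ᶜ).indicator (1 : Ω × Ω → ℝ) (z n)) ^ 2 =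
      ∑ k ∈ Finset.range M, (2 * (k : ℝ) + 1) * ((Set.diagonal Ω)ᶜ).indicator (1 : Ω × Ω → ℝ) (z k)
  | 0 => by simp
  | M + 1 => by
    rw [Finset.sum_range_succ, Finset.sum_range_succ, ← disagreementCount_sq_eq hz M, add_sq]
    by_cases hM : z M ∈ Set.diagonal Ω
    · have h0 : ((Set.diagonal Ω)ᶜ).indicator (1 : Ω × Ω → ℝ) (z M) = 0 :=
        Set.indicator_of_notMem (show z M ∉ (Set.diagonal Ω)ᶜ from fun h => h hM) _
      rw [h0]; ring
    · -- all earlier times are off the diagonal too, so the partial count is `M`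
      have h1 : ((Set.diagonal Ω)ᶜ).indicator (1 : Ω × Ω → ℝ) (z M) = 1 := by
        rw [Set.indicator_of_mem (show z M ∈ (Set.diagonal Ω)ᶜ from hM), Pi.one_apply]
      have hall : ∀ n ∈ Finset.range M, ((Set.diagonal Ω)ᶜ).indicator (1 : Ω × Ω → ℝ) (z n) = 1 := by
        intro n hn
        have hn' : z n ∉ Set.diagonal Ω := fun h => hM (hz n M (Finset.mem_range.1 hn).le h)
        rw [Set.indicator_of_mem (show z n ∈ (Set.diagonal Ω)ᶜ from hn'), Pi.one_apply]
      have hS : ∑ n ∈ Finset.range M, ((Set.diagonal Ω)ᶜ).indicator (1 : Ω × Ω → ℝ) (z n) = M := by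
        rw [Finset.sum_congr rfl hall, sum_const, card_range, nsmul_eq_mul, mul_one]
      rw [h1, hS]; ring

/-- **`E[T_M²] = Σ_{k<M}(2k + 1)·P(X_k ≠ X′_k)`** on the pair path law, from every initial coupling (`MeasurableEq Ω`). [ours] -/
theorem crn_chain_integral_disagreementCount_sq_eq [MeasurableEq Ω] (hw : Measurable w) (hw0 : ∀ y, 0 < w y)
    (Khat : Kernel (Ω × Ω) (Ω × Ω)) [IsMarkovKernel Khat]
    (hK : ∀ z : Ω × Ω, Khat z = (q.prod (volume : Measure unitInterval)).map (fun p : Ω × unitInterval =>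
      ((if (p.2 : ℝ) * w z.1 ≤ w p.1 then p.1 else z.1), (if (p.2 : ℝ) * w z.2 ≤ w p.1 then p.1 else z.2))))
    (μ₀ : Measure (Ω × Ω)) [IsProbabilityMeasure μ₀] (M : ℕ) :
    ∫ z, (∑ n ∈ Finset.range M, ((Set.diagonal Ω)ᶜ).indicator (1 : Ω × Ω → ℝ) (z n)) ^ 2
        ∂(Kernel.trajMeasure (X := fun _ : ℕ => Ω × Ω) μ₀
          (fun n : ℕ => Khat.comap (fun h : (i : ↥(Finset.Iic n)) → Ω × Ω => h ⟨n, Finset.mem_Iic.2 le_rfl⟩)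
            (measurable_pi_apply _))) =
      ∑ k ∈ Finset.range M, (2 * (k : ℝ) + 1) * ((fun m : Measure (Ω × Ω) => m.bind Khat)^[k] μ₀).real (Set.diagonal Ω)ᶜ := by
  set P := Kernel.trajMeasure (X := fun _ : ℕ => Ω × Ω) μ₀
      (fun n : ℕ => Khat.comap (fun h : (i : ↥(Finset.Iic n)) → Ω × Ω => h ⟨n, Finset.mem_Iic.2 le_rfl⟩)
        (measurable_pi_apply _)) with hP
  have hD : MeasurableSet (Set.diagonal Ω) := measurableSet_diagonal
  have hIm : Measurable ((Set.diagonal Ω)ᶜ.indicator (1 : Ω × Ω → ℝ)) := measurable_one.indicator hD.compl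
  have hIb : ∀ p : Ω × Ω, |(Set.diagonal Ω)ᶜ.indicator (1 : Ω × Ω → ℝ) p| ≤ 1 := by
    intro p
    by_cases hp : p ∈ (Set.diagonal Ω)ᶜ
    · rw [Set.indicator_of_mem hp, Pi.one_apply, abs_one]
    · rw [Set.indicator_of_notMem hp, abs_zero]; exact zero_le_one
  have hIi : ∀ n, Integrable (fun z : ℕ → Ω × Ω => (Set.diagonal Ω)ᶜ.indicator (1 : Ω × Ω → ℝ) (z n)) P := fun n =>
    integrable_of_bounded P (hIm.comp (measurable_pi_apply n)) (fun z => hIb _)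
  have hae : (fun z : ℕ → Ω × Ω => (∑ n ∈ Finset.range M, ((Set.diagonal Ω)ᶜ).indicator (1 : Ω × Ω → ℝ) (z n)) ^ 2) =ᵐ[P]
      fun z => ∑ k ∈ Finset.range M, (2 * (k : ℝ) + 1) * ((Set.diagonal Ω)ᶜ).indicator (1 : Ω × Ω → ℝ) (z k) := by
    filter_upwards [crn_chain_ae_merged_stay hw hw0 Khat hK μ₀] with z hz
    exact disagreementCount_sq_eq hz M
  rw [integral_congr_ae hae, integral_finsetSum _ fun k _ => (hIi k).const_mul _]
  refine sum_congr rfl fun k _ => ?_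
  rw [integral_const_mul, hP, chain_expect_eq_integral_iterate_bind Khat μ₀ hIm hIb k, integral_indicator_one hD.compl]

/-- **`E[T_M] = Σ_{k<M} P(X_k ≠ X′_k)`** on the pair path law, from every initial coupling. [ours, bookkeeping] -/
theorem crn_chain_integral_disagreementCount_eq [MeasurableEq Ω] (Khat : Kernel (Ω × Ω) (Ω × Ω)) [IsMarkovKernel Khat]
    (μ₀ : Measure (Ω × Ω)) [IsProbabilityMeasure μ₀] (M : ℕ) :
    ∫ z, (∑ n ∈ Finset.range M, ((Set.diagonal Ω)ᶜ).indicator (1 : Ω × Ω → ℝ) (z n)) ∂(Kernel.trajMeasure (X := fun _ : ℕ => Ω × Ω) μ₀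
          (fun n : ℕ => Khat.comap (fun h : (i : ↥(Finset.Iic n)) → Ω × Ω => h ⟨n, Finset.mem_Iic.2 le_rfl⟩)
            (measurable_pi_apply _))) =
      ∑ k ∈ Finset.range M, ((fun m : Measure (Ω × Ω) => m.bind Khat)^[k] μ₀).real (Set.diagonal Ω)ᶜ := by
  set P := Kernel.trajMeasure (X := fun _ : ℕ => Ω × Ω) μ₀
      (fun n : ℕ => Khat.comap (fun h : (i : ↥(Finset.Iic n)) → Ω × Ω => h ⟨n, Finset.mem_Iic.2 le_rfl⟩)
        (measurable_pi_apply _)) with hP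
  have hD : MeasurableSet (Set.diagonal Ω) := measurableSet_diagonal
  have hIm : Measurable ((Set.diagonal Ω)ᶜ.indicator (1 : Ω × Ω → ℝ)) := measurable_one.indicator hD.compl
  have hIb : ∀ p : Ω × Ω, |(Set.diagonal Ω)ᶜ.indicator (1 : Ω × Ω → ℝ) p| ≤ 1 := by
    intro p
    by_cases hp : p ∈ (Set.diagonal Ω)ᶜ
    · rw [Set.indicator_of_mem hp, Pi.one_apply, abs_one]
    · rw [Set.indicator_of_notMem hp, abs_zero]; exact zero_le_one
  have hIi : ∀ n, Integrable (fun z : ℕ → Ω × Ω => (Set.diagonal Ω)ᶜ.indicator (1 : Ω × Ω → ℝ) (z n)) P := fun n =>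
    integrable_of_bounded P (hIm.comp (measurable_pi_apply n)) (fun z => hIb _)
  rw [integral_finsetSum _ fun n _ => hIi n]
  refine sum_congr rfl fun k _ => ?_
  rw [hP, chain_expect_eq_integral_iterate_bind Khat μ₀ hIm hIb k, integral_indicator_one hD.compl]

/-! ## §2 From (cold, off-mode) with an atom-free proposal: the moments and the law, exactly -/

/-- **`E[T_M] = Σ_{n<M} rⁿ` EXACTLY** from the coupling (first run at the mode `x₀`, second run never at the mode), atom-free
proposal (`q{x₀} = 0`), `r = 1 − 1/w(x₀)`. [ours] -/
theorem crn_chain_integral_disagreementCount_eq_cold [MeasurableSingletonClass Ω] [MeasurableEq Ω] (hw : Measurable w) (hw0 : ∀ y, 0 < w y)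
    {x₀ : Ω} (hmax : ∀ y, w y ≤ w x₀) [IsProbabilityMeasure (q.withDensity fun y => ENNReal.ofReal (w y))]
    (hq0 : q {x₀} = 0) (Khat : Kernel (Ω × Ω) (Ω × Ω)) [IsMarkovKernel Khat]
    (hK : ∀ z : Ω × Ω, Khat z = (q.prod (volume : Measure unitInterval)).map (fun p : Ω × unitInterval =>
      ((if (p.2 : ℝ) * w z.1 ≤ w p.1 then p.1 else z.1), (if (p.2 : ℝ) * w z.2 ≤ w p.1 then p.1 else z.2))))
    (μ₀ : Measure (Ω × Ω)) [IsProbabilityMeasure μ₀] (hfst : μ₀.map Prod.fst = Measure.dirac x₀)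
    (hsnd : (μ₀.map Prod.snd) {x₀} = 0) (M : ℕ) :
    ∫ z, (∑ n ∈ Finset.range M, ((Set.diagonal Ω)ᶜ).indicator (1 : Ω × Ω → ℝ) (z n)) ∂(Kernel.trajMeasure (X := fun _ : ℕ => Ω × Ω) μ₀
          (fun n : ℕ => Khat.comap (fun h : (i : ↥(Finset.Iic n)) → Ω × Ω => h ⟨n, Finset.mem_Iic.2 le_rfl⟩)
            (measurable_pi_apply _))) =
      ∑ n ∈ Finset.range M, (1 - (w x₀)⁻¹) ^ n := by
  rw [crn_chain_integral_disagreementCount_eq Khat μ₀ M]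
  exact sum_congr rfl fun n _ => iterate_bind_crnPair_offDiagonal_eq hw hw0 hmax hq0 Khat hK n μ₀ hfst hsnd

/-- **`E[T_M²] = Σ_{k<M}(2k + 1)·r^k` EXACTLY** from (cold, off-mode) with an atom-free proposal. [ours] -/
theorem crn_chain_integral_disagreementCount_sq_eq_cold [MeasurableSingletonClass Ω] [MeasurableEq Ω] (hw : Measurable w) (hw0 : ∀ y, 0 < w y)
    {x₀ : Ω} (hmax : ∀ y, w y ≤ w x₀) [IsProbabilityMeasure (q.withDensity fun y => ENNReal.ofReal (w y))]
    (hq0 : q {x₀} = 0) (Khat : Kernel (Ω × Ω) (Ω × Ω)) [IsMarkovKernel Khat]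
    (hK : ∀ z : Ω × Ω, Khat z = (q.prod (volume : Measure unitInterval)).map (fun p : Ω × unitInterval =>
      ((if (p.2 : ℝ) * w z.1 ≤ w p.1 then p.1 else z.1), (if (p.2 : ℝ) * w z.2 ≤ w p.1 then p.1 else z.2))))
    (μ₀ : Measure (Ω × Ω)) [IsProbabilityMeasure μ₀] (hfst : μ₀.map Prod.fst = Measure.dirac x₀)
    (hsnd : (μ₀.map Prod.snd) {x₀} = 0) (M : ℕ) :
    ∫ z, (∑ n ∈ Finset.range M, ((Set.diagonal Ω)ᶜ).indicator (1 : Ω × Ω → ℝ) (z n)) ^ 2 ∂(Kernel.trajMeasure (X := fun _ : ℕ => Ω × Ω) μ₀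
          (fun n : ℕ => Khat.comap (fun h : (i : ↥(Finset.Iic n)) → Ω × Ω => h ⟨n, Finset.mem_Iic.2 le_rfl⟩)
            (measurable_pi_apply _))) =
      ∑ k ∈ Finset.range M, (2 * (k : ℝ) + 1) * (1 - (w x₀)⁻¹) ^ k := by
  rw [crn_chain_integral_disagreementCount_sq_eq hw hw0 Khat hK μ₀ M]
  exact sum_congr rfl fun k _ => by rw [iterate_bind_crnPair_offDiagonal_eq hw hw0 hmax hq0 Khat hK k μ₀ hfst hsnd]

/-- **THE GEOMETRIC LAW EXACTLY**: `P(T_M ≥ t) = r^{t−1}` for `1 ≤ t ≤ M` from (cold, off-mode) with an atom-free proposal — on almost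
every pair path `T_M ≥ t` iff the runs still differ at time `t − 1`. [ours] -/
theorem crn_chain_disagreementCount_tail_eq_cold [MeasurableSingletonClass Ω] [MeasurableEq Ω] (hw : Measurable w) (hw0 : ∀ y, 0 < w y)
    {x₀ : Ω} (hmax : ∀ y, w y ≤ w x₀) [IsProbabilityMeasure (q.withDensity fun y => ENNReal.ofReal (w y))]
    (hq0 : q {x₀} = 0) (Khat : Kernel (Ω × Ω) (Ω × Ω)) [IsMarkovKernel Khat]
    (hK : ∀ z : Ω × Ω, Khat z = (q.prod (volume : Measure unitInterval)).map (fun p : Ω × unitInterval =>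
      ((if (p.2 : ℝ) * w z.1 ≤ w p.1 then p.1 else z.1), (if (p.2 : ℝ) * w z.2 ≤ w p.1 then p.1 else z.2))))
    (μ₀ : Measure (Ω × Ω)) [IsProbabilityMeasure μ₀] (hfst : μ₀.map Prod.fst = Measure.dirac x₀)
    (hsnd : (μ₀.map Prod.snd) {x₀} = 0) {M t : ℕ} (ht : 1 ≤ t) (htM : t ≤ M) :
    (Kernel.trajMeasure (X := fun _ : ℕ => Ω × Ω) μ₀
          (fun n : ℕ => Khat.comap (fun h : (i : ↥(Finset.Iic n)) → Ω × Ω => h ⟨n, Finset.mem_Iic.2 le_rfl⟩)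
            (measurable_pi_apply _))).real
        {z | (t : ℝ) ≤ ∑ n ∈ Finset.range M, ((Set.diagonal Ω)ᶜ).indicator (1 : Ω × Ω → ℝ) (z n)} =
      (1 - (w x₀)⁻¹) ^ (t - 1) := by
  set P := Kernel.trajMeasure (X := fun _ : ℕ => Ω × Ω) μ₀
      (fun n : ℕ => Khat.comap (fun h : (i : ↥(Finset.Iic n)) → Ω × Ω => h ⟨n, Finset.mem_Iic.2 le_rfl⟩)
        (measurable_pi_apply _)) with hP
  -- a.e. the two events coincide
  have hae : {z : ℕ → Ω × Ω | (t : ℝ) ≤ ∑ n ∈ Finset.range M, ((Set.diagonal Ω)ᶜ).indicator (1 : Ω × Ω → ℝ) (z n)} =ᵐ[P]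
      {z | z (t - 1) ∉ Set.diagonal Ω} := by
    filter_upwards [crn_chain_ae_merged_stay hw hw0 Khat hK μ₀] with z hz
    refine propext ⟨fun hT => offDiagonal_of_le_disagreementCount hz ht hT, fun hoff => ?_⟩
    -- all times `≤ t − 1` are off the diagonal, so the count over `range M ⊇ range t` is at least `t`
    show (t : ℝ) ≤ ∑ n ∈ Finset.range M, ((Set.diagonal Ω)ᶜ).indicator (1 : Ω × Ω → ℝ) (z n)
    have hsub : Finset.range t ⊆ Finset.range M := Finset.range_subset_range.2 htM
    have hone : ∀ n ∈ Finset.range t, ((Set.diagonal Ω)ᶜ).indicator (1 : Ω × Ω → ℝ) (z n) = 1 := by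
      intro n hn
      have hn' : z n ∉ Set.diagonal Ω := fun h =>
        hoff (hz n (t - 1) (Nat.le_sub_one_of_lt (Finset.mem_range.1 hn)) h)
      rw [Set.indicator_of_mem (show z n ∈ (Set.diagonal Ω)ᶜ from hn'), Pi.one_apply]
    calc (t : ℝ) = ∑ n ∈ Finset.range t, ((Set.diagonal Ω)ᶜ).indicator (1 : Ω × Ω → ℝ) (z n) := by
          rw [Finset.sum_congr rfl hone, sum_const, card_range, nsmul_eq_mul, mul_one]
      _ ≤ ∑ n ∈ Finset.range M, ((Set.diagonal Ω)ᶜ).indicator (1 : Ω × Ω → ℝ) (z n) :=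
          Finset.sum_le_sum_of_subset_of_nonneg hsub fun n _ _ => Set.indicator_nonneg (fun _ _ => zero_le_one) _
  rw [measureReal_congr hae, hP, crn_chain_offDiagonal_real_eq Khat μ₀ (t - 1)]
  exact iterate_bind_crnPair_offDiagonal_eq hw hw0 hmax hq0 Khat hK (t - 1) μ₀ hfst hsnd

/-! ## §3 The constants `W` and `W(2W − 1)` are attained in the limit `M → ∞` -/

/-- **`E[T_M] → W`** as `M → ∞` from (cold, off-mode): the expectation certificate `E[T_M] ≤ P(X_0 ≠ X′_0)·W` of GEN-37 is sharp.
[ours] -/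
theorem tendsto_integral_disagreementCount_cold [MeasurableSingletonClass Ω] [MeasurableEq Ω] (hw : Measurable w) (hw0 : ∀ y, 0 < w y)
    {x₀ : Ω} (hmax : ∀ y, w y ≤ w x₀) [IsProbabilityMeasure (q.withDensity fun y => ENNReal.ofReal (w y))]
    (hq0 : q {x₀} = 0) (Khat : Kernel (Ω × Ω) (Ω × Ω)) [IsMarkovKernel Khat]
    (hK : ∀ z : Ω × Ω, Khat z = (q.prod (volume : Measure unitInterval)).map (fun p : Ω × unitInterval =>
      ((if (p.2 : ℝ) * w z.1 ≤ w p.1 then p.1 else z.1), (if (p.2 : ℝ) * w z.2 ≤ w p.1 then p.1 else z.2))))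
    (μ₀ : Measure (Ω × Ω)) [IsProbabilityMeasure μ₀] (hfst : μ₀.map Prod.fst = Measure.dirac x₀)
    (hsnd : (μ₀.map Prod.snd) {x₀} = 0) :
    Tendsto (fun M : ℕ => ∫ z, (∑ n ∈ Finset.range M, ((Set.diagonal Ω)ᶜ).indicator (1 : Ω × Ω → ℝ) (z n)) ∂(Kernel.trajMeasure (X := fun _ : ℕ => Ω × Ω) μ₀
          (fun n : ℕ => Khat.comap (fun h : (i : ↥(Finset.Iic n)) → Ω × Ω => h ⟨n, Finset.mem_Iic.2 le_rfl⟩)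
            (measurable_pi_apply _))))
      atTop (𝓝 (w x₀)) := by
  have hW : 1 ≤ w x₀ := one_le_of_mode (q := q) hmax
  have hWpos : 0 < w x₀ := hw0 x₀
  have hr0 : 0 ≤ 1 - (w x₀)⁻¹ := sub_nonneg.2 (inv_le_one_of_one_le₀ hW)
  have hr1 : 1 - (w x₀)⁻¹ < 1 := sub_lt_self _ (inv_pos.2 hWpos)
  have hgeo := hasSum_geometric_of_lt_one hr0 hr1
  have hlim : (1 - (1 - (w x₀)⁻¹))⁻¹ = w x₀ := by rw [sub_sub_cancel, inv_inv]
  rw [← hlim]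
  refine (hgeo.tendsto_sum_nat).congr fun M => ?_
  exact (crn_chain_integral_disagreementCount_eq_cold hw hw0 hmax hq0 Khat hK μ₀ hfst hsnd M).symm

/-- **`E[T_M²] → W(2W − 1)`** as `M → ∞` from (cold, off-mode): the second-moment certificate
`E[T_M²] ≤ P(X_0 ≠ X′_0)·W(2W − 1)` of this generation is sharp. [ours] -/
theorem tendsto_integral_disagreementCount_sq_cold [MeasurableSingletonClass Ω] [MeasurableEq Ω] (hw : Measurable w) (hw0 : ∀ y, 0 < w y)
    {x₀ : Ω} (hmax : ∀ y, w y ≤ w x₀) [IsProbabilityMeasure (q.withDensity fun y => ENNReal.ofReal (w y))]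
    (hq0 : q {x₀} = 0) (Khat : Kernel (Ω × Ω) (Ω × Ω)) [IsMarkovKernel Khat]
    (hK : ∀ z : Ω × Ω, Khat z = (q.prod (volume : Measure unitInterval)).map (fun p : Ω × unitInterval =>
      ((if (p.2 : ℝ) * w z.1 ≤ w p.1 then p.1 else z.1), (if (p.2 : ℝ) * w z.2 ≤ w p.1 then p.1 else z.2))))
    (μ₀ : Measure (Ω × Ω)) [IsProbabilityMeasure μ₀] (hfst : μ₀.map Prod.fst = Measure.dirac x₀)
    (hsnd : (μ₀.map Prod.snd) {x₀} = 0) :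
    Tendsto (fun M : ℕ => ∫ z, (∑ n ∈ Finset.range M, ((Set.diagonal Ω)ᶜ).indicator (1 : Ω × Ω → ℝ) (z n)) ^ 2 ∂(Kernel.trajMeasure (X := fun _ : ℕ => Ω × Ω) μ₀
          (fun n : ℕ => Khat.comap (fun h : (i : ↥(Finset.Iic n)) → Ω × Ω => h ⟨n, Finset.mem_Iic.2 le_rfl⟩)
            (measurable_pi_apply _))))
      atTop (𝓝 (w x₀ * (2 * w x₀ - 1))) := by
  have hW : 1 ≤ w x₀ := one_le_of_mode (q := q) hmax
  have hWpos : 0 < w x₀ := hw0 x₀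
  have hr0 : 0 ≤ 1 - (w x₀)⁻¹ := sub_nonneg.2 (inv_le_one_of_one_le₀ hW)
  have hr1 : 1 - (w x₀)⁻¹ < 1 := sub_lt_self _ (inv_pos.2 hWpos)
  have hnorm : ‖1 - (w x₀)⁻¹‖ < 1 := by rw [Real.norm_eq_abs, abs_of_nonneg hr0]; exact hr1
  have hA := hasSum_coe_mul_geometric_of_norm_lt_one hnorm
  have hB := hasSum_geometric_of_lt_one hr0 hr1
  have hAB : HasSum (fun k : ℕ => (2 * (k : ℝ) + 1) * (1 - (w x₀)⁻¹) ^ k)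
      (2 * ((1 - (w x₀)⁻¹) / (1 - (1 - (w x₀)⁻¹)) ^ 2) + (1 - (1 - (w x₀)⁻¹))⁻¹) := by
    have h := (hA.mul_left 2).add hB
    have hfun : (fun k : ℕ => (2 * (k : ℝ) + 1) * (1 - (w x₀)⁻¹) ^ k) =
        fun k : ℕ => 2 * ((k : ℝ) * (1 - (w x₀)⁻¹) ^ k) + (1 - (w x₀)⁻¹) ^ k := by
      funext k; ring
    rw [hfun]
    exact h
  have hlim : 2 * ((1 - (w x₀)⁻¹) / (1 - (1 - (w x₀)⁻¹)) ^ 2) + (1 - (1 - (w x₀)⁻¹))⁻¹ = w x₀ * (2 * w x₀ - 1) := by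
    field_simp
    ring
  rw [← hlim]
  refine (hAB.tendsto_sum_nat).congr fun M => ?_
  exact (crn_chain_integral_disagreementCount_sq_eq_cold hw hw0 hmax hq0 Khat hK μ₀ hfst hsnd M).symm

end Summit.Ventures.LatticeQCDFlow.Exactness

end
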